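import Summits.QuantumFields.YangMills.Theorems.LuscherReductionDressedRitzPolyakovLiftStaticsDressedResidual
import HarnessLib

/-!
# Line «polyakovlift» r3 on crux `DressedRitz` (stmt-QuantumFields-20205), stub S-STAT over the dressed family — the owner's T5 twin:
# after time-dressing, the static datum is the TIME-`2L` CONNECTED TWO-POINT FUNCTION of the (undressed) flowed insertions

Fleet-service module of seat ym-infvol-p1 g5 (route `LuscherReduction`, femto rung R2b1).  Owner word (W1·g25) 2026-08-27T12:18:59Z, supplement T5:
«`stub_liftStatics_of_lawCorrelation` (p525510) — the LAW CHANGES: equal-time covariance ↦ time-`2L` connected two-point function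
`l2 (ins φ f̂) (K^{2L} ins φ ĥ)`, (o2) order unchanged».  This file types exactly that for the r3 text (`dressedLiftFamily = K_β^[dressSteps L] ∘ liftFamily`):

* `l2_dressedLiftVec_eq_twoPoint` — `⟨u'_f, u'_h⟩ = ⟨u_f, K_β^{2m} u_h⟩` (`m = dressSteps L`; symmetry of `K_β`): every static datum of the dressed family is
  a time-`2m` connected vacuum two-point function of the UNDRESSED channel vectors `u_f = OpPlat.ins φ (flowLiftAt 0 t f)`;
* ★ `dressed_stub_liftStatics_of_twoPoint` — the registered r3 stub `stub_liftStatics` (conclusion = its body VERBATIM) follows from the (o2)-type bound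
  on that two-point function alone: `|⟨u_i, K^{2m}u_l⟩| ≤ C·λ·√⟨u_i, K^{2m}u_i⟩·√⟨u_l, K^{2m}u_l⟩` (`i ≠ l`) for every raw vacuum and lift basis, eventually
  in the femto window ((o0) is the tree's `dressedLiftFamily_o0`).  This is the honest Lean signature of what S-STAT still owes after the reshape:
  the `O(λ)` decorrelation of distinct flowed Polyakov eigen-ratio channels at Euclidean separation `2L` — an OPEN renormalisation-group estimate
  (Lüscher's femto-universe effective theory with non-perturbative control; perturbative only in print).

HONEST FRAMING: fixed-lattice bookkeeping on the CONDITIONAL femto rung R2b1; nothing of the RG estimate is proved; nothing here bears on infinite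
volume, the continuum limit or the Clay gap.  References: M. Lüscher, NPB 219 (1983) 233, §3 [cite: Luscher1983, §3]; M. Lüscher, U. Wolff,
NPB 339 (1990) 222 [cite: LuscherWolff1990].
-/

set_option autoImplicit false

noncomputable section

open MeasureTheory Filter Topology
open Literature.MathematicalPhysics.QuantumFieldTheory
open Literature.MathematicalPhysics.QuantumLattice
open scoped BigOperators

namespace Summit.QuantumFields.YangMills.Theorems.FemtoTransferGap.PolyakovLift

open Summit.QuantumFields.YangMills.Theorems.FemtoTransferGap

section TwoPoint

variable {L : ℕ} [NeZero L]

/-- **`⟨u'_f, u'_h⟩ = ⟨u_f, K_β^{2m} u_h⟩`** (`u' = K_β^m u`, `m = dressSteps L`): the static data of the dressed family are time-`2m` connected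
two-point functions of the undressed channel vectors. [cite: LuscherWolff1990] -/
theorem l2_dressedLiftVec_eq_twoPoint (β : ℝ) {φ : GaugeConfig 3 L SU2 → ℝ} (hφ : IsPhys φ) {f h : GaugeConfig 3 1 SU2 → ℝ}
    (hf : IsPhys f) (hh : IsPhys h) :
    l2 (dressedLiftVec β φ f) (dressedLiftVec β φ h) =
      l2 (liftVec β φ f) ((transferApply β)^[dressSteps L + dressSteps L] (liftVec β φ h)) := by
  unfold dressedLiftVec
  rw [l2_iterate_left_right β (isPhys_liftVec β hφ hf) (isPhys_liftVec β hφ hh) (dressSteps L) (dressSteps L), l2_comm]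
  have e := l2_iterate_left_right β (isPhys_liftVec β hφ hh) (isPhys_liftVec β hφ hf) (dressSteps L + dressSteps L) 0
  simp only [Function.iterate_zero, id_eq, zero_add] at e
  rw [e]
  exact l2_comm _ _

/-- The same for the families: `⟨u'_i, u'_l⟩ = ⟨u_i, K_β^{2m} u_l⟩`. [cite: LuscherWolff1990] -/
theorem l2_dressedLiftFamily_eq_twoPoint (β : ℝ) {φ : GaugeConfig 3 L SU2 → ℝ} (hφ : IsPhys φ) {k : ℕ}
    {g : Fin k → (GaugeConfig 3 1 SU2 → ℝ)} (hg : ∀ i, IsPhys (g i)) (i l : Fin k) :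
    l2 (dressedLiftFamily β φ g i) (dressedLiftFamily β φ g l) =
      l2 (liftFamily β φ g i) ((transferApply β)^[dressSteps L + dressSteps L] (liftFamily β φ g l)) :=
  l2_dressedLiftVec_eq_twoPoint β hφ (hg i) (hg l)

end TwoPoint

section Residual

/-- ★ **THE r3 STUB FROM THE TIME-`2m` TWO-POINT BOUND (owner's T5 twin of `stub_liftStatics_of_lawCorrelation`).**  If for every `k` there are
`C ≥ 0`, `lam0 > 0` such that eventually in the femto window, for every raw vacuum `φ` and every lift basis at `B₁ = 2/λ³`, the undressed channel
vectors `u_i = liftFamily β φ g i` satisfy `|⟨u_i, K_β^{2m}u_l⟩| ≤ C·λ·√⟨u_i, K_β^{2m}u_i⟩·√⟨u_l, K_β^{2m}u_l⟩` (`i ≠ l`, `m = dressSteps L`), then the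
registered stub `stub_liftStatics` of r3 holds (conclusion = its body VERBATIM; (o0) = `dressedLiftFamily_o0`).  The hypothesis is the OPEN estimate.
[cite: Luscher1983, §3] [cite: LuscherWolff1990] -/
theorem dressed_stub_liftStatics_of_twoPoint
    (h2 : ∀ k : ℕ, ∃ C lam0 : ℝ, 0 ≤ C ∧ 0 < lam0 ∧ ∀ lam : ℝ, 0 < lam → lam ≤ lam0 → ∃ L0 : ℕ,
      ∀ (L : ℕ) [NeZero L], L0 ≤ L → ∀ β : ℝ, InFemtoWindow lam β L →
        ∀ φ : GaugeConfig 3 L SU2 → ℝ, IsRawVacuum β φ →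
          ∀ (ω : GaugeConfig 3 1 SU2 → ℝ) (g : Fin k → (GaugeConfig 3 1 SU2 → ℝ)), LiftBasis (liftCoupling β L) k ω g →
            ∀ i l : Fin k, i ≠ l →
              |l2 (liftFamily β φ g i) ((transferApply β)^[dressSteps L + dressSteps L] (liftFamily β φ g l))| ≤
                C * luscherLambda β L *
                  (Real.sqrt (l2 (liftFamily β φ g i) ((transferApply β)^[dressSteps L + dressSteps L] (liftFamily β φ g i))) *
                    Real.sqrt (l2 (liftFamily β φ g l) ((transferApply β)^[dressSteps L + dressSteps L] (liftFamily β φ g l))))) :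
    ∀ k : ℕ, ∃ C lam0 : ℝ, 0 ≤ C ∧ 0 < lam0 ∧ ∀ lam : ℝ, 0 < lam → lam ≤ lam0 → ∃ L0 : ℕ,
      ∀ (L : ℕ) [NeZero L], L0 ≤ L → ∀ β : ℝ, InFemtoWindow lam β L →
        ∀ φ : GaugeConfig 3 L SU2 → ℝ, IsRawVacuum β φ →
          ∀ (ω : GaugeConfig 3 1 SU2 → ℝ) (g : Fin k → (GaugeConfig 3 1 SU2 → ℝ)), LiftBasis (liftCoupling β L) k ω g →
            StaticClauses k C β (dressedLiftFamily β φ g) := by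
  refine dressed_stub_liftStatics_of_o2 fun k => ?_
  obtain ⟨C, lam0, hC, hlam0, h⟩ := h2 k
  refine ⟨C, lam0, hC, hlam0, fun lam hlam hle => ?_⟩
  obtain ⟨L0, hL0⟩ := h lam hlam hle
  refine ⟨L0, fun L _ hL β hW φ hvac ω g hbasis i l hil => ?_⟩
  have hg : ∀ j, IsPhys (g j) := hbasis.2.2.2.2.1
  rw [l2_dressedLiftFamily_eq_twoPoint β hvac.1 hg i l, l2_dressedLiftFamily_eq_twoPoint β hvac.1 hg i i,
    l2_dressedLiftFamily_eq_twoPoint β hvac.1 hg l l]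
  exact hL0 L hL β hW φ hvac ω g hbasis i l hil

end Residual

end Summit.QuantumFields.YangMills.Theorems.FemtoTransferGap.PolyakovLift

end
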